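import Literature.MathematicalPhysics.QuantumFieldTheory.Balaban1983to89.Node00.Record13
import Literature.MathematicalPhysics.QuantumFieldTheory.Balaban1983to89.Node00.Record13SepCoPH
import Literature.MathematicalPhysics.QuantumFieldTheory.Balaban1983to89.Node00.Record13Carriers
import Literature.MathematicalPhysics.QuantumFieldTheory.Balaban1983to89.Node00.CarriersB8
import Literature.MathematicalPhysics.QuantumFieldTheory.Balaban1983to89.Node00.Record13SClassSepCoPH
import Literature.MathematicalPhysics.QuantumFieldTheory.Balaban1983to89.Node00.N24NodesWindowStage12C
import Literature.MathematicalPhysics.QuantumFieldTheory.Balaban1983to89.T4DatumAssemblyTower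
import Summits.QuantumFields.YangMills.Theorems.BalabanUVNodesN26AtRecord13BetaBoxOfDriftAtSlope

/-!
# BalabanUVNodes ∕ K1⁷ — THE REGISTERED STUB 2 `stub_betaWindow13PWS` IN ITS GENERIC FORM: rung 1 ⇒ rung 2 FOR EVERY RUNG-1 WITNESS, MODULO THE β-BOX AT
# THAT WITNESS (floor free, ceiling = the witness's own `w.βup`), the non-vacuity window PRODUCED from the upper letter alone

TRACK A (YM-PLAN §2d), node N24 (binder B2, COMPOSITE), WIDTH SEAT `pub-ymgap-dag-n24-w1` (director-ym №197 ∕ HUMAN RULING D-0149; plan g77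
`W-SEAT-START-LIST.md` v2 §1 n24 ITEM 1).  Key of record: K1⁷ `StabilityBAtRecordR13SepCoPH` = stmt-QuantumFields-20542; this file `--supports` it AS A HELPER
(count-neutral).  The registered skeleton of record is plan's `K1Skeleton13SepCoPHv5.lean` (sha16 38c62055d1ac34a4): rung 1 `NodesAtSomeRecord13PWS F`, rung 2
`BetaWindowAtSomeRecord13S F`, stub 2 `stub_betaWindow13PWS : ∀ F, NodesAtSomeRecord13PWS F → BetaWindowAtSomeRecord13S F`, the record class `RecordS F θ h w`
(tree twin: dag-n10-d's `Node00.IsRecordOfRecord₁₃CSepCoPHS`, `recordS₁₃SepCoPH_iff` = `Iff.rfl`).  The other three names are SKELETON-LOCAL, so — as the sibling seats dag-n12-d ∕ dag-n24-c do — their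
∃-bodies are STATED LITERALLY below (at `N := 2` the texts of §5 ARE the registered antecedent ∕ consequent with `RecordS` unfolded).

WHAT RUNG 2 ADDS TO RUNG 1 (same `(θ, h, w)`-prefix, `PrintedUV3V` and the [IV]-pin dropped): (a) the interval β-binder
`DagBinding.BetaBoundsInInterval w.C.toB12 w.γ w.b w.βup` ([Balaban1987RG1] (1.22) p. 264; the lower half `0 < w.b ≤ β` printed NOWHERE in the series, cell
census T09.F) and (b) the non-vacuity window `∃ γ₁ > 0, ∀ γ ∈ ]0, γ₁], ∃ P, 1 ≤ P.K ∧ InInterval γ P.K` at `Node00.datumOfRecord₁₃SepCoPH F N θ h` ((b) follows from the UPPER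
half of (a) read at `j = 0` — the first β-function bounded above near `0⁺`; dag-n13-w4's located reading, its `…N13WindowAtRecord13SepCoPH`).  The datum's
run-wise β IS the β of record `Node00.betaOfRecord₁₃ F N θ.toStage13Params` curried at the forward-generated history (def-T `βfun_datumOfRecord₁₃SepCoPH`,
`T4DatumAssemblyTower.RGMachineCore.construction`, `rfl`) — a `betaOfMerged ∕ beta0OfMerged` object ([Balaban1987RG1] (1.20)–(1.22) on the merged term (1.6))
that NO admissibility clause and NO proviso row of `Stage13HParams` reads.  Hence the two box letters are NOT this stub's to prove: the UPPER one is [Balaban1987RG1]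
§1 p. 264 «uniformly bounded on this interval» (stated, proof unpublished — the K2⁷ (D1)+(D4) ∕ K0⁷ stub 3ᴬ lane, N26's `betaBox_betaOfRecord₁₃_of_drift_atSlopeCont`),
the LOWER one is NODE O's (discrete) asymptotic freedom `FlowStep.BetaAFH`.

WHAT IS GENERIC — and proved here, for EVERY rung-1 witness at once:
* §1 `nodes_leavesP_reletter_of_le` — THE THIRTEEN DAG NODES ARE ANTITONE IN THE WORLD's WINDOW LETTER `γ` AND BLIND TO ITS FLOOR `b`: of the 22 leaves of
  `DagBinding.leavesP w P` the nodes `Dag.B4_main … B16_main` name `smallCouplings` (`InInterval w.γ`) only as an ANTECEDENT whose consequents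
  (`smallFieldInductive`, `densitiesDescribed`, `uvBounds`) the other nodes supply outright, and `flowControl` (the only `βup ∕ β₀`-reading leaf) only as an
  antecedent of N11 — so `Nodes (leavesP w P) → Nodes (leavesP {w with γ := γ', b := b'} P)` for every `γ' ≤ w.γ`, `b' > 0` (pure propositional bookkeeping;
  n24-a's `N24_nodes_withB_iff` is the `γ' = w.γ` case).  The CEILING is NOT free: N11 = `Dag.B14_main` reads `flowControl` at `w.βup`, which re-letters
  DOWNWARD only: `flowIneq26_mono_ceiling` ∕ `nodes_leavesP_reletter_ceiling_of_le` ((2.6) [III] is MONOTONE in `β′` along positive couplings, so a SMALLER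
  ceiling `β′ ≤ w.βup` also keeps the nodes).
* §2 `recordS₁₃SepCoPH_reletter_of_le` — plan's `RecordS F θ h w` (spelled out) is kept under the same re-lettering with `0 < γ' ≤ w.γ`; `isRecordOfRecord₁₃CSepCoPHS_reletter_of_le` —
  the same in dag-n10-d's tree-twin currency `Node00.IsRecordOfRecord₁₃CSepCoPHS F N D w` (`recordS₁₃SepCoPH_iff`, `Iff.rfl`).
* §3 `betaBoundsInInterval_datumOfRecord₁₃SepCoPH_of_boxH` — (a) at the datum of record from the two box letters on `betaOfRecord₁₃` (NODE 00's
  `RGMachineCore.betaBoundsInInterval_construction`, `rfl` faces).  (b) is NOT declared here: the datum-level window step has ONE declarer in the w-wave (dag-n13-w4,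
  `Thm/…N13WindowAtRecord13SepCoPH`, dag-lead DEDUP-354); this file routes through n24-a's tree lemma `N24_window_of_betaUpperH` BY NAME.
* §4 ★ `betaWindowAtSomeRecordS₁₃SepCoPH_of_rung1At_of_boxH` (general `N`) — FROM ANY RUNG-1 DATUM `(θ, h, w)` (unity ∧ non-degeneracy, admissibility,
  `RecordS`, the thirteen nodes at every run) AND THE LETTERS `0 < γ₀`, `0 < b`, `BetaLowerH b γ₀ β_θ`, `BetaUpperH w.βup γ₀ β_θ`: the rung-2 ∃-body,
  WITNESSED AT `(θ, h, {w with γ := min w.γ γ₀, b := b})`; the window by n24-a's `N24_window_of_betaUpperH` (upper letter ALONE).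
* §4b `betaWindow_of_isRecordOfRecord₁₃CSepCoPHS_of_nodes_of_boxH` — the D-KEYED form at ANY S-class record `(D, w)`: nodes + `BetaLowerH b γ₀ D.βfun` + `BetaUpperH w.βup γ₀ D.βfun`
  ⊢ the re-lettered world is again an S-class record over `D` with the nodes, the interval binder and the window (n24-a's Stage-12 `N24_betaWindow₁₂C_of_nodes_of_boxH`, one
  stage up and with the window letter freed).
* §5 ★★ `stub_betaWindow13PWS_of_boxH_at_witness` (`N = 2`, the REGISTERED texts verbatim) — `NodesAtSomeRecord13PWS F` ⟹ `BetaWindowAtSomeRecord13S F` GIVEN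
  «the β-box at every rung-1 witness»: `BetaAFH β_θ` (NODE O's floor on SOME window) and `∃ γ₁ > 0, BetaUpperH w.βup γ₁ β_θ` (the witness's ceiling dominates
  β on SOME window).  THIS IS THE REGISTERED STUB 2 REDUCED TO ONE LOCATED LETTER PAIR, for every witness at once.
* §6 `betaWindowAtSomeRecordS₁₃SepCoPH_of_rung1At_of_drift_atSlopeCont` — §4 with the pair supplied BY NAME from the K2 letters (N26,
  `betaBox_betaOfRecord₁₃_of_drift_atSlopeCont`: `OneLoopDrift d A β⁰_θ`, `AtSlopeCont (split₁₃ θ) γ₀ s`, floor `d − 2A − s > 0`, ceiling `d + 2A + s ≤ w.βup`).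

HONEST SCOPE ∕ A6.  Every theorem here is an implication whose β-letters (`hlo ∕ hhi`, `BetaAFH`, the drift ∕ residue pair) are DISPLAYED HYPOTHESES owned by
NODE O ∕ K2⁷ ∕ K0⁷ 3ᴬ; they are inhabited at NO θ in this file («not exhibited», №167) — the rung-1 antecedent itself is K1⁷ stub 1's ∕ K0⁷'s product.  Nothing
of Bałaban's is asserted; stub 2 is NOT closed, K1⁷ is NOT closed, N24 stays COMPOSITE — no discharge, no count claim (typed 28∕28 · discharged 5∕27 unmoved).
One finite 𝕋⁴ programme at fixed ε, Bałaban AS PRINTED; R4 closes ONLY the conditional finite-𝕋⁴ rung `BalabanLadder.UV` — the YM mass gap (Clay) is NOT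
proved by any of this; nothing continuum ∕ ℝ⁴ ∕ OS.  Theorems only: no `def`, no `instance`, no `sorry`, standard axioms.
-/

noncomputable section

open scoped Matrix.Norms.L2Operator

namespace Summit.QuantumFields.YangMills.BalabanUVNodes.K1BetaWindow13SOfNodes13PWSOfBoxH

open Literature.MathematicalPhysics.QuantumFieldTheory.Balaban1983to89
open Literature.MathematicalPhysics.QuantumFieldTheory.Balaban1983to89.Node00
open DagBinding T4Continuum T4DatumAssembly FlowStepRuns
open FlowStep (BetaLowerH BetaUpperH BetaAFH box_mono)
open Literature.MathematicalPhysics.QuantumFieldTheory.Balaban1983to89.Beta.Drift (OneLoopDrift)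
open Summit.QuantumFields.BalabanUV.Gaps.BetaContFromD4Chain (AtSlopeCont)
open Summit.QuantumFields.YangMills.Theorems.BalabanUVNodesN26AtRecord13BetaBoxOfDriftAtSlope (betaBox_betaOfRecord₁₃_of_drift_atSlopeCont)

/-! ## §1. The thirteen DAG nodes are antitone in the world's window letter `γ` and blind to its floor `b` -/

section Reletter

/-- **THE THIRTEEN DAG NODES ARE ANTITONE IN THE WORLD's WINDOW LETTER AND BLIND TO ITS FLOOR.**  For a dependence-function world `w`, any `γ' ≤ w.γ` and any
floor `b' > 0`: if the thirteen paper nodes hold at the `leavesP` binding of `w` for the run `P`, they hold at the binding of `{w with γ := γ', b := b'}`.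
Reason (pure propositional bookkeeping over `Dag.B4_main … B16_main`): the re-lettered binding has the SAME leaves `b4 … b13`, `smallFieldInductive`, `rOperation`,
`rBasicStep`, `densitiesDescribed`, `uvBounds`, `flowControl` (they read `w.up`, `w.C`, `w.em`, `w.ep`, `w.βup`, `w.β₀` only); `smallCouplings` SHRINKS
(`InInterval γ' ⊆ InInterval w.γ`) and is named by N09 ∕ N11 ∕ N13 only as an antecedent whose consequents the nodes at `w` deliver outright; `b` is read by no
node (only by `betaPositive ∕ running ∕ thm2Regime`, cf. n24-a's `N24_nodes_withB_iff`).  [cite: Balaban1989LargeFieldII, Introduction pp.355–356 (the citation DAG); Balaban1988Convergent, Thm 1 p.262 and (2.6) p.255 (where `γ`, `β⁺` enter; bookkeeping)] -/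
theorem nodes_leavesP_reletter_of_le (w : WorldP) {γ' b' : ℝ} (hγ' : γ' ≤ w.γ) (hb' : 0 < b') (P : B12.RunParams)
    (hn : Nodes (leavesP w P)) : Nodes (leavesP { w with γ := γ', b := b', b_pos := hb' } P) := by
  obtain ⟨h4, h5, h6, h7, h8, h9, h10, h11, h12, h13, h14, h15, h16⟩ := hn
  have b4 : (leavesP w P).b4 := h4
  have b5 : (leavesP w P).b5 := h5 b4
  have b6 : (leavesP w P).b6 := h6 b4 b5
  have b7 : (leavesP w P).b7 := h7 b5
  have b9 : (leavesP w P).b9 := h9 b4 b5 b6 b7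
  have b8 : (leavesP w P).b8 := h8 b5 b6 b7 b9
  have b11 : (leavesP w P).b11 := h11 b5 b6 b7 b8 b9
  have b10 : (leavesP w P).b10 := h10 b5 b6 b7 b8 b9 b11
  obtain ⟨b12, h12'⟩ := h12 b4 b5 b6 b7 b8 b9 b10 b11
  have b13 : (leavesP w P).b13 := h13 b9 b10 b11 b12
  have sFI : (leavesP w P).smallCouplings → (leavesP w P).smallFieldInductive := h12' b12 b13
  have rB : (leavesP w P).rBasicStep := h15 b5 b7 b8 b10 b11
  obtain ⟨rOp, h16'⟩ := h16 b5 b6 b7 b9 b10 b11 b13 rB sFI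
  -- the only γ-reading leaf shrinks
  have hsc : (leavesP { w with γ := γ', b := b', b_pos := hb' } P).smallCouplings → (leavesP w P).smallCouplings :=
    fun h k hk => ⟨(h k hk).1, (h k hk).2.trans hγ'⟩
  refine ⟨b4, fun _ => b5, fun _ _ => b6, fun _ => b7, fun _ _ _ _ => b8, fun _ _ _ _ => b9, fun _ _ _ _ _ _ => b10,
    fun _ _ _ _ _ => b11, fun _ _ _ _ _ _ _ _ => ⟨b12, fun _ _ hsc' => sFI (hsc hsc')⟩, fun _ _ _ _ => b13,
    fun _ _ _ _ _ _ hfc _ hsc' => h14 b7 b8 b9 b10 b11 sFI (fun _ => hfc hsc') rOp (hsc hsc'), fun _ _ _ _ _ => rB,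
    fun _ _ _ _ _ _ _ _ _ => ⟨rOp, fun hdd hsc' => h16' (fun _ => hdd hsc') (hsc hsc')⟩⟩

/-- The same for ALL runs at once. [cite: Balaban1989LargeFieldII, Introduction pp.355–356 (bookkeeping)] -/
theorem nodes_leavesP_reletter_of_le_all (w : WorldP) {γ' b' : ℝ} (hγ' : γ' ≤ w.γ) (hb' : 0 < b')
    (hn : ∀ P : B12.RunParams, Nodes (leavesP w P)) (P : B12.RunParams) : Nodes (leavesP { w with γ := γ', b := b', b_pos := hb' } P) :=
  nodes_leavesP_reletter_of_le w hγ' hb' P (hn P)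

/-- **(2.6) [Balaban1988Convergent] IS MONOTONE IN THE CEILING `β′` ALONG NON-NEGATIVE COUPLINGS**: `g_n ≤ (1 + g_n² β′ (n−m))^{1/2} g_m` weakens as `β′` grows (`g_m ≥ 0`); the second
clause does not read `β′`. [cite: Balaban1988Convergent, (2.6) p.255] -/
theorem flowIneq26_mono_ceiling {g : ℕ → ℝ} {β' β'' β₀ : ℝ} {K : ℕ} (h : B14.FlowIneq26 g β' β₀ K) (hle : β' ≤ β'')
    (hpos : ∀ k, k ≤ K → 0 ≤ g k) : B14.FlowIneq26 g β'' β₀ K := by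
  intro m n hmn hnK
  obtain ⟨h1, h2⟩ := h m n hmn hnK
  refine ⟨h1.trans (mul_le_mul_of_nonneg_right (Real.sqrt_le_sqrt ?_) (hpos m (by omega))), h2⟩
  have hnm : (0 : ℝ) ≤ (n : ℝ) - m := sub_nonneg.mpr (by exact_mod_cast hmn.le)
  have hq : 0 ≤ g n ^ 2 * ((n : ℝ) - m) := mul_nonneg (sq_nonneg _) hnm
  nlinarith [mul_le_mul_of_nonneg_left hle hq]

/-- **THE NODES RE-LETTER THE CEILING DOWNWARD**: for `β′ ≤ w.βup` the thirteen nodes at `w` give the nodes at `{w with βup := β′}` — N11 = `Dag.B14_main` reads `flowControl` as an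
antecedent under `smallCouplings` (positive couplings), where (2.6) at the smaller ceiling implies (2.6) at `w.βup` (`flowIneq26_mono_ceiling`); no other node reads `βup`.
(UPWARD is NOT available: (2.6) at a larger ceiling is weaker.) [cite: Balaban1988Convergent, Thm 1 p.262 and (2.6) p.255 (bookkeeping)] -/
theorem nodes_leavesP_reletter_ceiling_of_le (w : WorldP) {β' : ℝ} (hle : β' ≤ w.βup) (P : B12.RunParams)
    (hn : Nodes (leavesP w P)) : Nodes (leavesP { w with βup := β' } P) := by
  obtain ⟨h4, h5, h6, h7, h8, h9, h10, h11, h12, h13, h14, h15, h16⟩ := hn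
  have b4 : (leavesP w P).b4 := h4
  have b5 : (leavesP w P).b5 := h5 b4
  have b6 : (leavesP w P).b6 := h6 b4 b5
  have b7 : (leavesP w P).b7 := h7 b5
  have b9 : (leavesP w P).b9 := h9 b4 b5 b6 b7
  have b8 : (leavesP w P).b8 := h8 b5 b6 b7 b9
  have b11 : (leavesP w P).b11 := h11 b5 b6 b7 b8 b9
  have b10 : (leavesP w P).b10 := h10 b5 b6 b7 b8 b9 b11
  obtain ⟨b12, h12'⟩ := h12 b4 b5 b6 b7 b8 b9 b10 b11
  have b13 : (leavesP w P).b13 := h13 b9 b10 b11 b12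
  have sFI : (leavesP w P).smallCouplings → (leavesP w P).smallFieldInductive := h12' b12 b13
  have rB : (leavesP w P).rBasicStep := h15 b5 b7 b8 b10 b11
  obtain ⟨rOp, h16'⟩ := h16 b5 b6 b7 b9 b10 b11 b13 rB sFI
  -- the only βup-reading leaf, under `smallCouplings`, re-letters upward to `w.βup`
  have hfc' : ((leavesP { w with βup := β' } P).smallCouplings → (leavesP { w with βup := β' } P).flowControl) →
      ((leavesP w P).smallCouplings → (leavesP w P).flowControl) :=
    fun hfc hsc => flowIneq26_mono_ceiling (hfc hsc) hle fun k hk => (hsc k hk).1.le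
  exact ⟨b4, fun _ => b5, fun _ _ => b6, fun _ => b7, fun _ _ _ _ => b8, fun _ _ _ _ => b9, fun _ _ _ _ _ _ => b10,
    fun _ _ _ _ _ => b11, fun _ _ _ _ _ _ _ _ => ⟨b12, fun _ _ hsc => sFI hsc⟩, fun _ _ _ _ => b13,
    fun _ _ _ _ _ _ hfc _ hsc => h14 b7 b8 b9 b10 b11 sFI (hfc' hfc) rOp hsc, fun _ _ _ _ _ => rB,
    fun _ _ _ _ _ _ _ _ _ => ⟨rOp, fun hdd hsc => h16' hdd hsc⟩⟩

end Reletter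

/-! ## §2. Plan's S-bound record class `RecordS F θ h w` (spelled out) under the same re-lettering -/

section RecordS

variable {F : T4Family} {N : ℕ} [NeZero N]

/-- **plan's `RecordS F θ h w` DOES NOT READ THE FLOOR AND ACCEPTS ANY SMALLER POSITIVE WINDOW**: its clauses bind `w.C`, `w.L`, `w.up` (unchanged by the re-lettering)
and ask `0 < w.γ ≤ θ'.γ` of the presenting parameter `θ'` — so `0 < γ' ≤ w.γ` keeps it.  (The body is the skeleton's `RecordS` = def-T's `IsRecordOfRecord₁₃CSepCoPH` with
`upOfRecord₅C ↦ upOfRecord₅CS`, general `N`; = dag-n10-d's tree twin `IsRecordOfRecord₁₃CSepCoPHS F N (datumOfRecord₁₃SepCoPH F N θ h) w` by `recordS₁₃SepCoPH_iff`.) [cite: Balaban1989LargeFieldII, Thm 1 p.355; Balaban1985RegularSpaces, Thm 8 p.101 (the S-binding's surviving leaf; bookkeeping)] -/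
theorem recordS₁₃SepCoPH_reletter_of_le {θ : Stage13HParams F N} {h : θ.Provisos₁₃SepCoPH F N} {w : WorldP}
    (hR : ∃ (θ' : Stage13HParams F N) (h' : θ'.Provisos₁₃SepCoPH F N), θ'.Admissible F N ∧
      datumOfRecord₁₃SepCoPH F N θ h = datumOfRecord₁₃SepCoPH F N θ' h' ∧ w.C = (datumOfRecord₁₃SepCoPH F N θ h).C ∧ (0 < w.γ ∧ w.γ ≤ θ'.γ) ∧
      w.L = (θ'.L : ℝ) ∧ ∀ P : B12.RunParams, w.up P = upOfRecord₅CS F N (θ'.toStage5₁₃CoPH F N) P)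
    {γ' b' : ℝ} (hγ'0 : 0 < γ') (hγ' : γ' ≤ w.γ) (hb' : 0 < b') :
    ∃ (θ' : Stage13HParams F N) (h' : θ'.Provisos₁₃SepCoPH F N), θ'.Admissible F N ∧
      datumOfRecord₁₃SepCoPH F N θ h = datumOfRecord₁₃SepCoPH F N θ' h' ∧
      ({ w with γ := γ', b := b', b_pos := hb' } : WorldP).C = (datumOfRecord₁₃SepCoPH F N θ h).C ∧
      (0 < ({ w with γ := γ', b := b', b_pos := hb' } : WorldP).γ ∧ ({ w with γ := γ', b := b', b_pos := hb' } : WorldP).γ ≤ θ'.γ) ∧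
      ({ w with γ := γ', b := b', b_pos := hb' } : WorldP).L = (θ'.L : ℝ) ∧
      ∀ P : B12.RunParams, ({ w with γ := γ', b := b', b_pos := hb' } : WorldP).up P = upOfRecord₅CS F N (θ'.toStage5₁₃CoPH F N) P := by
  obtain ⟨θ', h', hθ', hD, hC, hγ, hL, hup⟩ := hR
  exact ⟨θ', h', hθ', hD, hC, ⟨hγ'0, hγ'.trans hγ.2⟩, hL, hup⟩

/-- **THE SAME IN THE TREE-TWIN CURRENCY** `Node00.IsRecordOfRecord₁₃CSepCoPHS F N D w` (dag-n10-d `Record13SClassSepCoPH`; plan's `RecordS F θ h w` ↔ it at `D := datumOfRecord₁₃SepCoPH θ h` by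
`recordS₁₃SepCoPH_iff`, `Iff.rfl`): the S-class does not read the floor and accepts any smaller positive window. [cite: Balaban1989LargeFieldII, Thm 1 p.355 (bookkeeping)] -/
theorem isRecordOfRecord₁₃CSepCoPHS_reletter_of_le {D : FiniteEpsData F (SU N)} {w : WorldP} (hR : IsRecordOfRecord₁₃CSepCoPHS F N D w)
    {γ' b' : ℝ} (hγ'0 : 0 < γ') (hγ' : γ' ≤ w.γ) (hb' : 0 < b') :
    IsRecordOfRecord₁₃CSepCoPHS F N D { w with γ := γ', b := b', b_pos := hb' } := by
  obtain ⟨θ', h', hθ', hD, hC, hγ, hL, hup⟩ := hR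
  exact ⟨θ', h', hθ', hD, hC, ⟨hγ'0, hγ'.trans hγ.2⟩, hL, hup⟩

end RecordS

/-! ## §3. The interval β-binder at the Stage-13 datum of record from the two box letters on `betaOfRecord₁₃` -/

section Binder

variable {F : T4Family} {N : ℕ} [NeZero N]

/-- **(a) AT THE DATUM OF RECORD FROM THE BOX LETTERS**: `b ≤ β_θ ≤ β⁺` on the boxes `]0, γ₀]^{k+1}` of the β of record `betaOfRecord₁₃ F N θ` give
`BetaBoundsInInterval (datumOfRecord₁₃SepCoPH F N θ h).C.toB12 γ₀ b β⁺` — the datum's construction IS `(coreOfRecord₁₃CoPH θ).construction densOfRecord₁₃` whose run-wise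
`β (j+1) x` curries `betaOfRecord₁₃ θ` at the generated history `(g_0, …, g_{j−1}, x)` (NODE 00's `RGMachineCore.betaBoundsInInterval_construction`; every face `rfl`).
[cite: Balaban1987RG1, §1 (1.22) p.264 and (0.17)–(0.20) pp.255–256; Balaban1989LargeFieldII, Thm 1 p.355 (the binder's consumer; bookkeeping)] -/
theorem betaBoundsInInterval_datumOfRecord₁₃SepCoPH_of_boxH (θ : Stage13HParams F N) (h : θ.Provisos₁₃SepCoPH F N) {γ₀ b βup : ℝ}
    (hlo : BetaLowerH b γ₀ (betaOfRecord₁₃ F N θ.toStage13Params)) (hhi : BetaUpperH βup γ₀ (betaOfRecord₁₃ F N θ.toStage13Params)) :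
    BetaBoundsInInterval (datumOfRecord₁₃SepCoPH F N θ h).C.toB12 γ₀ b βup :=
  (coreOfRecord₁₃CoPH F N θ).betaBoundsInInterval_construction (fun p k => densOfRecord₁₃ F N θ.toStage13Params p k) hlo hhi

end Binder

/-! ## §4. ★ Rung 2's body from ANY rung-1 datum `(θ, h, w)` and the box letters at `θ` (floor free, ceiling `w.βup`) -/

section Rung

variable {F : T4Family} {N : ℕ} [NeZero N]

/-- **★ RUNG 2 (`BetaWindowAtSomeRecord13S`'s ∃-body, general `N`) FROM ANY RUNG-1 DATUM AND THE β-BOX AT ITS θ.**  Given a unity Stage-13 tuple `θ` with provisos `h`,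
`θ.Admissible`, a world `w` in plan's S-bound record class of the datum (`RecordS`, spelled out) all of whose runs' leaf worlds satisfy the thirteen DAG nodes — i.e. the
`(θ, h, w)`-part of a rung-1 witness — and box letters `0 < γ₀`, `0 < b` with `b ≤ betaOfRecord₁₃ θ ≤ w.βup` on `]0, γ₀]^{k+1}` (the LOWER letter = NODE O's floor, UNPRINTED,
T09.F; the UPPER = [Balaban1987RG1] §1 p.264 «uniformly bounded», read against the witness's OWN ceiling `w.βup`): the rung-2 body holds, witnessed at
`(θ, h, {w with γ := min w.γ γ₀, b := b})` — record class by §2, nodes by §1, the interval binder by §3 on the shrunk window (`box_mono`), the window by n24-a's `N24_window_of_betaUpperH` BY NAME (the datum-level window step has ONE declarer in the w-wave, seat dag-n13-w4's `…N13WindowAtRecord13SepCoPH`; not restated here).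
CONDITIONAL on the two letters; nothing of Bałaban asserted; stub 2 NOT closed by this (the letters are displayed, not discharged).
[cite: Balaban1989LargeFieldII, Thm 1 p.355 + (0.1) pp.355–356 + p.391; Balaban1987RG1, (1.22) p.264, Thm 2 (0.31) p.259, (0.17)–(0.20) pp.255–256; Balaban1988Convergent, (2.6) p.255 (bookkeeping + elementary window)] -/
theorem betaWindowAtSomeRecordS₁₃SepCoPH_of_rung1At_of_boxH (θ : Stage13HParams F N) (h : θ.Provisos₁₃SepCoPH F N) (w : WorldP)
    (hU : θ.ZhUnity F N ∧ θ.SlotsNondegenerate₁₃ F N) (hθ : θ.Admissible F N)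
    (hR : ∃ (θ' : Stage13HParams F N) (h' : θ'.Provisos₁₃SepCoPH F N), θ'.Admissible F N ∧
      datumOfRecord₁₃SepCoPH F N θ h = datumOfRecord₁₃SepCoPH F N θ' h' ∧ w.C = (datumOfRecord₁₃SepCoPH F N θ h).C ∧ (0 < w.γ ∧ w.γ ≤ θ'.γ) ∧
      w.L = (θ'.L : ℝ) ∧ ∀ P : B12.RunParams, w.up P = upOfRecord₅CS F N (θ'.toStage5₁₃CoPH F N) P)
    (hnodes : ∀ P : B12.RunParams, Nodes (leavesP w P))
    {γ₀ b : ℝ} (hγ₀ : 0 < γ₀) (hb : 0 < b)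
    (hlo : BetaLowerH b γ₀ (betaOfRecord₁₃ F N θ.toStage13Params)) (hhi : BetaUpperH w.βup γ₀ (betaOfRecord₁₃ F N θ.toStage13Params)) :
    ∃ (θ : Stage13HParams F N) (hP : θ.Provisos₁₃SepCoPH F N) (w : WorldP), (θ.ZhUnity F N ∧ θ.SlotsNondegenerate₁₃ F N) ∧ θ.Admissible F N ∧
      (∃ (θ' : Stage13HParams F N) (h' : θ'.Provisos₁₃SepCoPH F N), θ'.Admissible F N ∧
        datumOfRecord₁₃SepCoPH F N θ hP = datumOfRecord₁₃SepCoPH F N θ' h' ∧ w.C = (datumOfRecord₁₃SepCoPH F N θ hP).C ∧ (0 < w.γ ∧ w.γ ≤ θ'.γ) ∧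
        w.L = (θ'.L : ℝ) ∧ ∀ P : B12.RunParams, w.up P = upOfRecord₅CS F N (θ'.toStage5₁₃CoPH F N) P) ∧
      (∀ P : B12.RunParams, Nodes (leavesP w P)) ∧ BetaBoundsInInterval w.C.toB12 w.γ w.b w.βup ∧
      ∃ γ₁ : ℝ, 0 < γ₁ ∧ ∀ γ : ℝ, 0 < γ → γ ≤ γ₁ → ∃ P : B12.RunParams, 1 ≤ P.K ∧ ((datumOfRecord₁₃SepCoPH F N θ hP).C P).flow.InInterval γ P.K := by
  have hγw : 0 < w.γ := by
    obtain ⟨_, _, _, _, _, hγ, _⟩ := hR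
    exact hγ.1
  have hC : w.C = (datumOfRecord₁₃SepCoPH F N θ h).C := by
    obtain ⟨_, _, _, _, hC, _⟩ := hR
    exact hC
  have hm0 : 0 < min w.γ γ₀ := lt_min hγw hγ₀
  refine ⟨θ, h, { w with γ := min w.γ γ₀, b := b, b_pos := hb }, hU, hθ,
    recordS₁₃SepCoPH_reletter_of_le hR hm0 (min_le_left _ _) hb, nodes_leavesP_reletter_of_le_all w (min_le_left _ _) hb hnodes, ?_,
    N24_window_of_betaUpperH (datumOfRecord₁₃SepCoPH F N θ h) hγ₀ hhi⟩
  show BetaBoundsInInterval w.C.toB12 (min w.γ γ₀) b w.βup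
  rw [hC]
  exact betaBoundsInInterval_datumOfRecord₁₃SepCoPH_of_boxH θ h (fun k v hv => hlo k v (box_mono (min_le_right _ _) k hv))
    (fun k v hv => hhi k v (box_mono (min_le_right _ _) k hv))

/-- **★ THE SAME WITH THE TWO LETTERS ON SEPARATE WINDOWS, IN NODE O's CURRENCY**: `BetaAFH (betaOfRecord₁₃ θ)` (= `∃ γ₀ > 0, ∃ b > 0, BetaLowerH b γ₀`, FlowStep's
«(β-AF)_hist», UNPRINTED T09.F) and `∃ γ₁ > 0, BetaUpperH w.βup γ₁ (betaOfRecord₁₃ θ)` (the witness's ceiling dominates β on SOME window) — windows merged by `min`,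
boxes restricted by `FlowStep.box_mono`. [cite: Balaban1987RG1, Thm 2 (0.31) p.259 and §1 p.264; Balaban1989LargeFieldII, Thm 1 p.355 (bookkeeping)] -/
theorem betaWindowAtSomeRecordS₁₃SepCoPH_of_rung1At_of_betaAFH_of_ceiling (θ : Stage13HParams F N) (h : θ.Provisos₁₃SepCoPH F N) (w : WorldP)
    (hU : θ.ZhUnity F N ∧ θ.SlotsNondegenerate₁₃ F N) (hθ : θ.Admissible F N)
    (hR : ∃ (θ' : Stage13HParams F N) (h' : θ'.Provisos₁₃SepCoPH F N), θ'.Admissible F N ∧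
      datumOfRecord₁₃SepCoPH F N θ h = datumOfRecord₁₃SepCoPH F N θ' h' ∧ w.C = (datumOfRecord₁₃SepCoPH F N θ h).C ∧ (0 < w.γ ∧ w.γ ≤ θ'.γ) ∧
      w.L = (θ'.L : ℝ) ∧ ∀ P : B12.RunParams, w.up P = upOfRecord₅CS F N (θ'.toStage5₁₃CoPH F N) P)
    (hnodes : ∀ P : B12.RunParams, Nodes (leavesP w P))
    (hAF : BetaAFH (betaOfRecord₁₃ F N θ.toStage13Params)) (hceil : ∃ γ₁ : ℝ, 0 < γ₁ ∧ BetaUpperH w.βup γ₁ (betaOfRecord₁₃ F N θ.toStage13Params)) :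
    ∃ (θ : Stage13HParams F N) (hP : θ.Provisos₁₃SepCoPH F N) (w : WorldP), (θ.ZhUnity F N ∧ θ.SlotsNondegenerate₁₃ F N) ∧ θ.Admissible F N ∧
      (∃ (θ' : Stage13HParams F N) (h' : θ'.Provisos₁₃SepCoPH F N), θ'.Admissible F N ∧
        datumOfRecord₁₃SepCoPH F N θ hP = datumOfRecord₁₃SepCoPH F N θ' h' ∧ w.C = (datumOfRecord₁₃SepCoPH F N θ hP).C ∧ (0 < w.γ ∧ w.γ ≤ θ'.γ) ∧
        w.L = (θ'.L : ℝ) ∧ ∀ P : B12.RunParams, w.up P = upOfRecord₅CS F N (θ'.toStage5₁₃CoPH F N) P) ∧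
      (∀ P : B12.RunParams, Nodes (leavesP w P)) ∧ BetaBoundsInInterval w.C.toB12 w.γ w.b w.βup ∧
      ∃ γ₁ : ℝ, 0 < γ₁ ∧ ∀ γ : ℝ, 0 < γ → γ ≤ γ₁ → ∃ P : B12.RunParams, 1 ≤ P.K ∧ ((datumOfRecord₁₃SepCoPH F N θ hP).C P).flow.InInterval γ P.K := by
  obtain ⟨γ₀, hγ₀, b, hb, hlo⟩ := hAF
  obtain ⟨γ₁, hγ₁, hhi⟩ := hceil
  exact betaWindowAtSomeRecordS₁₃SepCoPH_of_rung1At_of_boxH θ h w hU hθ hR hnodes (lt_min hγ₀ hγ₁) hb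
    (fun k v hv => hlo k v (box_mono (min_le_left _ _) k hv)) (fun k v hv => hhi k v (box_mono (min_le_right _ _) k hv))

/-- **★ THE D-KEYED FORM AT ANY S-CLASS RECORD `(D, w)`** (n24-a's Stage-12 `N24_betaWindow₁₂C_of_nodes_of_boxH` one stage up, window letter FREED): an S-class record all of whose runs' leaf
worlds satisfy the thirteen nodes, NODE O's floor `b ≤ D.βfun` and the witness's ceiling `D.βfun ≤ w.βup` on `]0, γ₀]^{k+1}` give — AT THE WORLD RE-LETTERED TO `(min w.γ γ₀, b)`, again an
S-class record over `D` with the same nodes — the interval β-binder and the non-vacuity window.  CONDITIONAL on the two letters; nothing of Bałaban asserted.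
[cite: Balaban1987RG1, §1 (1.22) p.264, Thm 2 p.259 and (0.17)–(0.20) pp.255–256; Balaban1989LargeFieldII, Thm 1 p.355 (bookkeeping + elementary window)] -/
theorem betaWindow_of_isRecordOfRecord₁₃CSepCoPHS_of_nodes_of_boxH {D : FiniteEpsData F (SU N)} {w : WorldP} (hR : IsRecordOfRecord₁₃CSepCoPHS F N D w)
    (hnodes : ∀ P : B12.RunParams, Nodes (leavesP w P)) {γ₀ b : ℝ} (hγ₀ : 0 < γ₀) (hb : 0 < b)
    (hlo : BetaLowerH b γ₀ D.βfun) (hhi : BetaUpperH w.βup γ₀ D.βfun) :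
    IsRecordOfRecord₁₃CSepCoPHS F N D { w with γ := min w.γ γ₀, b := b, b_pos := hb } ∧
      (∀ P : B12.RunParams, Nodes (leavesP { w with γ := min w.γ γ₀, b := b, b_pos := hb } P)) ∧
      BetaBoundsInInterval w.C.toB12 (min w.γ γ₀) b w.βup ∧
      ∃ γ₁ : ℝ, 0 < γ₁ ∧ ∀ γ : ℝ, 0 < γ → γ ≤ γ₁ → ∃ P : B12.RunParams, 1 ≤ P.K ∧ (D.C P).flow.InInterval γ P.K := by
  have hγw : 0 < w.γ := gamma_pos_of_isRecordOfRecord₁₃CSepCoPHS hR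
  refine ⟨isRecordOfRecord₁₃CSepCoPHS_reletter_of_le hR (lt_min hγw hγ₀) (min_le_left _ _) hb,
    nodes_leavesP_reletter_of_le_all w (min_le_left _ _) hb hnodes, ?_, N24_window_of_betaUpperH D hγ₀ hhi⟩
  obtain ⟨θ, h, _, hD, hC, -⟩ := hR
  rw [hC, hD]
  subst hD
  exact betaBoundsInInterval_datumOfRecord₁₃SepCoPH_of_boxH θ h (fun k v hv => hlo k v (box_mono (min_le_right _ _) k hv))
    (fun k v hv => hhi k v (box_mono (min_le_right _ _) k hv))

end Rung

/-! ## §5. ★★ `N = 2`: the REGISTERED stub 2 `NodesAtSomeRecord13PWS F → BetaWindowAtSomeRecord13S F` (texts verbatim, `RecordS` unfolded) GIVEN the β-box at every rung-1 witness -/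

section Registered

/-- **★★ K1⁷ STUB 2 IN ITS REGISTERED TEXT, REDUCED TO THE β-BOX AT THE RUNG-1 WITNESS.**  Antecedent = plan's `NodesAtSomeRecord13PWS F` (v5, sha16 38c62055d1ac34a4) with
`RecordS` unfolded, VERBATIM; consequent = plan's `BetaWindowAtSomeRecord13S F`, VERBATIM.  The ONE extra hypothesis `hbox` is «at every rung-1 witness `(θ, h, w)`: NODE O's
floor `BetaAFH (betaOfRecord₁₃ F 2 θ)` on SOME window, and the witness's ceiling dominates β on SOME window, `∃ γ₁ > 0, BetaUpperH w.βup γ₁ (betaOfRecord₁₃ F 2 θ)`» — it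
receives EVERY rung-1 conjunct (unity, non-degeneracy, admissibility, `RecordS`, the thirteen nodes, print's [B10] sentence `PrintedUV3V 2 θ.L`, the [IV]-pin at a genuine
step) as antecedents, so it is the weakest letter pair the extend-the-witness road can ask.  WHY THE CEILING IS THE WITNESS's: N11 = `Dag.B14_main` reads `flowControl`
(`B14.FlowIneq26 … w.βup w.β₀`) as an antecedent, so `Nodes` re-letters `βup` downward only (§1) — a rung-1 world whose `βup` undercuts its own β of record cannot be
extended and must be re-built (dag-n24-c's worlds take `w.βup := β′` from the K0 box and comply).  CONDITIONAL; stub 2 ∕ K1⁷ NOT closed; no count moved.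
[cite: Balaban1989LargeFieldII, Thm 1 p.355 + (0.1) pp.355–356 + p.391; Balaban1987RG1, Thm 2 (0.31) p.259, §1 (1.22) p.264, (0.17)–(0.20) pp.255–256; Balaban1985UV3, Thm 1 p.257 + Thm 2 p.272; Balaban1989LargeFieldI, Prop. 1 p.194 (the rung-1 conjuncts passed through; bookkeeping)] -/
theorem stub_betaWindow13PWS_of_boxH_at_witness (F : T4Family)
    (hbox : ∀ (θ : Stage13HParams F 2) (h : θ.Provisos₁₃SepCoPH F 2) (w : WorldP),
      (θ.ZhUnity F 2 ∧ θ.SlotsNondegenerate₁₃ F 2) → θ.Admissible F 2 →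
      (∃ (θ' : Stage13HParams F 2) (h' : θ'.Provisos₁₃SepCoPH F 2), θ'.Admissible F 2 ∧
        datumOfRecord₁₃SepCoPH F 2 θ h = datumOfRecord₁₃SepCoPH F 2 θ' h' ∧ w.C = (datumOfRecord₁₃SepCoPH F 2 θ h).C ∧ (0 < w.γ ∧ w.γ ≤ θ'.γ) ∧
        w.L = (θ'.L : ℝ) ∧ ∀ P : B12.RunParams, w.up P = upOfRecord₅CS F 2 (θ'.toStage5₁₃CoPH F 2) P) →
      (∀ P : B12.RunParams, Nodes (leavesP w P)) → PrintedUV3V 2 θ.L →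
      (∃ lam : ResidW F 2, (∀ P : B12.RunParams, 1 ≤ P.K → lam.kSel P < P.K) ∧
        ∀ P : B12.RunParams, lam.kSel P < P.K → ((leavesP w P).rBasicStep ↔ B15Leaf (WOfRecord₁₃ F 2 θ.toStage13Params lam P))) →
      BetaAFH (betaOfRecord₁₃ F 2 θ.toStage13Params) ∧ ∃ γ₁ : ℝ, 0 < γ₁ ∧ BetaUpperH w.βup γ₁ (betaOfRecord₁₃ F 2 θ.toStage13Params))
    (h₁ : ∃ (θ : Stage13HParams F 2) (h : θ.Provisos₁₃SepCoPH F 2) (w : WorldP), (θ.ZhUnity F 2 ∧ θ.SlotsNondegenerate₁₃ F 2) ∧ θ.Admissible F 2 ∧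
      (∃ (θ' : Stage13HParams F 2) (h' : θ'.Provisos₁₃SepCoPH F 2), θ'.Admissible F 2 ∧
        datumOfRecord₁₃SepCoPH F 2 θ h = datumOfRecord₁₃SepCoPH F 2 θ' h' ∧ w.C = (datumOfRecord₁₃SepCoPH F 2 θ h).C ∧ (0 < w.γ ∧ w.γ ≤ θ'.γ) ∧
        w.L = (θ'.L : ℝ) ∧ ∀ P : B12.RunParams, w.up P = upOfRecord₅CS F 2 (θ'.toStage5₁₃CoPH F 2) P) ∧
      (∀ P : B12.RunParams, Nodes (leavesP w P)) ∧ PrintedUV3V 2 θ.L ∧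
      ∃ lam : ResidW F 2, (∀ P : B12.RunParams, 1 ≤ P.K → lam.kSel P < P.K) ∧
        ∀ P : B12.RunParams, lam.kSel P < P.K → ((leavesP w P).rBasicStep ↔ B15Leaf (WOfRecord₁₃ F 2 θ.toStage13Params lam P))) :
    ∃ (θ : Stage13HParams F 2) (h : θ.Provisos₁₃SepCoPH F 2) (w : WorldP), (θ.ZhUnity F 2 ∧ θ.SlotsNondegenerate₁₃ F 2) ∧ θ.Admissible F 2 ∧
      (∃ (θ' : Stage13HParams F 2) (h' : θ'.Provisos₁₃SepCoPH F 2), θ'.Admissible F 2 ∧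
        datumOfRecord₁₃SepCoPH F 2 θ h = datumOfRecord₁₃SepCoPH F 2 θ' h' ∧ w.C = (datumOfRecord₁₃SepCoPH F 2 θ h).C ∧ (0 < w.γ ∧ w.γ ≤ θ'.γ) ∧
        w.L = (θ'.L : ℝ) ∧ ∀ P : B12.RunParams, w.up P = upOfRecord₅CS F 2 (θ'.toStage5₁₃CoPH F 2) P) ∧
      (∀ P : B12.RunParams, Nodes (leavesP w P)) ∧
      BetaBoundsInInterval w.C.toB12 w.γ w.b w.βup ∧
      ∃ γ₁ : ℝ, 0 < γ₁ ∧ ∀ γ : ℝ, 0 < γ → γ ≤ γ₁ → ∃ P : B12.RunParams, 1 ≤ P.K ∧ ((datumOfRecord₁₃SepCoPH F 2 θ h).C P).flow.InInterval γ P.K := by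
  obtain ⟨θ, h, w, hU, hθ, hR, hnodes, h08, hlam⟩ := h₁
  obtain ⟨hAF, hceil⟩ := hbox θ h w hU hθ hR hnodes h08 hlam
  exact betaWindowAtSomeRecordS₁₃SepCoPH_of_rung1At_of_betaAFH_of_ceiling θ h w hU hθ hR hnodes hAF hceil

end Registered

/-! ## §6. §4 with the box supplied BY NAME from the K2 letters at θ (N26 `betaBox_betaOfRecord₁₃_of_drift_atSlopeCont`) -/

section Drift

variable {F : T4Family} {N : ℕ} [NeZero N]

/-- **RUNG 2 FROM ANY RUNG-1 DATUM AND THE K2 PAIR's LETTERS AT ITS θ** — the (D1) drift `OneLoopDrift d A β⁰_θ` of the record's one-loop numbers and the row-(D4) ∧ B4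
residue `AtSlopeCont (split₁₃ θ) γ₀ s` (N26's hypotheses VERBATIM), with a POSITIVE floor `0 < d − 2A − s` (the AF content: the drift letter dominates the residue) and the
witness's ceiling `d + 2A + s ≤ w.βup`: N26's `betaBox_betaOfRecord₁₃_of_drift_atSlopeCont` gives the letter pair of §4 BY NAME.  CONDITIONAL on the K2 pair; nothing of
Bałaban asserted; stub 2 NOT closed. [cite: Balaban1987RG1, Thm 2 p.259, §1 p.264, (2.12)–(2.14) p.268 and (5.10) p.293; Balaban1988RG2Cluster, Lemma 3 (2.38) p.20; Balaban1989LargeFieldII, Thm 1 p.355 (bookkeeping)] -/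
theorem betaWindowAtSomeRecordS₁₃SepCoPH_of_rung1At_of_drift_atSlopeCont (θ : Stage13HParams F N) (h : θ.Provisos₁₃SepCoPH F N) (w : WorldP)
    (hU : θ.ZhUnity F N ∧ θ.SlotsNondegenerate₁₃ F N) (hθ : θ.Admissible F N)
    (hR : ∃ (θ' : Stage13HParams F N) (h' : θ'.Provisos₁₃SepCoPH F N), θ'.Admissible F N ∧
      datumOfRecord₁₃SepCoPH F N θ h = datumOfRecord₁₃SepCoPH F N θ' h' ∧ w.C = (datumOfRecord₁₃SepCoPH F N θ h).C ∧ (0 < w.γ ∧ w.γ ≤ θ'.γ) ∧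
      w.L = (θ'.L : ℝ) ∧ ∀ P : B12.RunParams, w.up P = upOfRecord₅CS F N (θ'.toStage5₁₃CoPH F N) P)
    (hnodes : ∀ P : B12.RunParams, Nodes (leavesP w P))
    {d A γ₀ s : ℝ} (hγ₀ : 0 < γ₀)
    (hdrift : letI := θ.instVβ₁; letI := θ.instVβ₂; letI := θ.instιβ
      OneLoopDrift d A (beta0OfMerged (betaMerged F (mergedTermFamilyMatT F N (TcanOfRecord F N) (chiFixed29 F N θ.ν θ.ε₂₉) θ.εbg) θ.ρ8 θ.bV) θ.v₀))
    (hres : letI := θ.instVβ₁; letI := θ.instVβ₂; letI := θ.instιβ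
      AtSlopeCont
        (oneLoopSplit_betaOfMerged (betaMerged F (mergedTermFamilyMatT F N (TcanOfRecord F N) (chiFixed29 F N θ.ν θ.ε₂₉) θ.εbg) θ.ρ8 θ.bV)
          (beta0OfMerged (betaMerged F (mergedTermFamilyMatT F N (TcanOfRecord F N) (chiFixed29 F N θ.ν θ.ε₂₉) θ.εbg) θ.ρ8 θ.bV) θ.v₀) θ.γ)
        γ₀ s)
    (hfloor : 0 < d - 2 * A - s) (hceil : d + 2 * A + s ≤ w.βup) :
    ∃ (θ : Stage13HParams F N) (hP : θ.Provisos₁₃SepCoPH F N) (w : WorldP), (θ.ZhUnity F N ∧ θ.SlotsNondegenerate₁₃ F N) ∧ θ.Admissible F N ∧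
      (∃ (θ' : Stage13HParams F N) (h' : θ'.Provisos₁₃SepCoPH F N), θ'.Admissible F N ∧
        datumOfRecord₁₃SepCoPH F N θ hP = datumOfRecord₁₃SepCoPH F N θ' h' ∧ w.C = (datumOfRecord₁₃SepCoPH F N θ hP).C ∧ (0 < w.γ ∧ w.γ ≤ θ'.γ) ∧
        w.L = (θ'.L : ℝ) ∧ ∀ P : B12.RunParams, w.up P = upOfRecord₅CS F N (θ'.toStage5₁₃CoPH F N) P) ∧
      (∀ P : B12.RunParams, Nodes (leavesP w P)) ∧ BetaBoundsInInterval w.C.toB12 w.γ w.b w.βup ∧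
      ∃ γ₁ : ℝ, 0 < γ₁ ∧ ∀ γ : ℝ, 0 < γ → γ ≤ γ₁ → ∃ P : B12.RunParams, 1 ≤ P.K ∧ ((datumOfRecord₁₃SepCoPH F N θ hP).C P).flow.InInterval γ P.K := by
  obtain ⟨hlo, hhi⟩ := betaBox_betaOfRecord₁₃_of_drift_atSlopeCont F N θ.toStage13Params hdrift hres le_rfl hceil
  exact betaWindowAtSomeRecordS₁₃SepCoPH_of_rung1At_of_boxH θ h w hU hθ hR hnodes hγ₀ hfloor hlo hhi

end Drift

end Summit.QuantumFields.YangMills.BalabanUVNodes.K1BetaWindow13SOfNodes13PWSOfBoxH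

end
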